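import Mathlib
import HarnessLib
import HarnessLib.Audit
import Summits.Schanuel.Statement
import Literature.NumberTheory.Transcendental.ZilberField
import Literature.Barriers.Schanuel.AlgebraicIndependenceOfLogarithms

/-!
Route: BilinearExp

CLOSED (retired) 2026-08-15T13:50:53Z by operator:999:1257524 — reason: not-a-thesis: assembly does not conclude the sub-problem Statement — note: D-0027 §2.1 audit (human 2026-08-15: routes that do not decide the summit are removed): the assembly concludes `CurveMeetsBilinExp`, not the sub-problem statement; a NEW conforming route may be opened from the same idea (generated `closes : … → _root_.Schanuel`).. The file is kept as the record of this route; refuted decls are indexed as negative knowledge (`ledger negatives`).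

# Route BilinearExp — Heisenberg sheets — the bilinear exponential e^{zw} meets every curve;
pairing-split Exponential Closedness

Realises card bilinear-exponential-heisenberg-kernel on the closedness side, for the card's own
object, the BILINEAR EXPONENTIAL
G = {(e^z, e^w, e^{zw}) : z, w ∈ ℂ} ⊆ (ℂˣ)³ ("the exponential of the multiplication table"). X (it
suffices to show): every
positive-dimensional algebraic subset of the torus (ℂˣ)³ meets G — equivalently every irreducible
algebraic curve C ⊆ (ℂˣ)³ carries a
point (e^z, e^w, e^{zw}). For multiplicatively free C this is exactly Zilber's Exponential
Closedness (rank-2 crux EacComplex of route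
Zilber) for the variety V = Γ_mult × C ⊆ ℂ³ × (ℂˣ)³, Γ_mult = {(s, t, st)}: ambient dimension 3,
additive projection a NON-LINEAR,
NON-DOMINANT surface — outside every proved case (n = 1; dim π₁V = n BM17; dim π₁V = 1 MM24; L × W
with L linear, Gallinaro2022) and at
the printed frontier (all of ℂ² × (ℂˣ)² is settled, arXiv:2409.12860 p.14). X is decomposed into an
analytic large-sheet fixed-point
lemma and an algebraic branch lemma; the ranked cruxes carry the same engine up the ladder Γ_{1,n} ×
W and Γ_{m,n} × W (pairing-split EC).
Lean: `∀ I : Ideal (MvPolynomial (Fin 3) ℂ), (MvPolynomial.zeroLocus ℂ I ∩ {p | ∀ i, p i ≠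
0}).Infinite → ∃ z w : ℂ, ![Complex.exp z, Complex.exp w, Complex.exp (z * w)] ∈
MvPolynomial.zeroLocus ℂ I`

## Assembly
Pure logic plus e^{u+2πil} = e^u (PROVED sorry-free in the planner's Sketch.lean, theorem
assembly_holds): given I with V(I) ∩ (ℂˣ)³
infinite, CurveBranchOverRealArc gives three cases. Vertical line: take z = log a₀, w = log b₀, the
point (a₀, b₀, e^{zw}) lies on it.
Branch over a: LargeSheetFixedPoint yields z, l with e^{z(B(z)+2πil)} = Γ(z); put w := B(z) + 2πil,
so (e^z, e^w, e^{zw}) =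
(e^z, e^{B(z)}, Γ(z)) ∈ V(I). Branch over b: the same with z := A(w) + 2πil and zw = wz. The
assembly ends in the route's own target
(rung route, like ModulusFirst): X is EC-side and implies nothing about Schanuel (arXiv:2409.12860
p.15), exactly as route Zilber's
rank-2 crux EacComplex; the ranked cruxes 2–3 are the continuation of the same engine and are not
needed for X.

Rationale: WHY THIS LINE. The card's observation (H) — the sheets of the logarithm act on the fibre of G over
(e^z, e^w) through the Heisenberg cocycle,
e^{(z+2πik)(w+2πil)} = e^{zw}·e^{2πi(lz+kw)}·e^{−4π²kl} (support HeisenbergFibre) — becomes an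
EXISTENCE ENGINE: on the sheet w ↦ w + 2πil
the third coordinate picks up the factor e^{2πilz}, which stays bounded exactly when Im z ≈ 0, so
solutions accumulate at the wall
{a = e^z > 0}; there the equation e^{z(B(z)+2πil)} = Γ(z) for holomorphic branch data (b, c) =
(e^{B}, Γ) of the curve is the fixed
point of the contraction z ↦ (log(Γe^{−zB})(z) + 2πim)/(2πil), l ≫ 1 (support LargeSheetFixedPoint;
checked numerically on
C = {b = 1+a, c = a²+3}: residuals 1e-13, arg a → 0, file sheet_contraction_test.py). This is
Marker's one-variable picture (Marker2006;
arXiv:2409.12860 Thm 3.7) transplanted to a two-variable system by letting one sheet index do the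
work of the second variable — available
ONLY because the exponent is bilinear (squares e^{z²} force growth e^{x²−y²} on large sheets and
need tropical control at infinity,
which is why the card's Veronese Φ₂ is not the object filed). Imported: complex analysis (Banach
fixed point, holomorphic logarithms,
implicit function theorem); the EC frame and its partial results (BrownawellMasser2017,
AslanyanKirbyMantova2021 arXiv:2105.12679,
MantovaMasser2023 arXiv:2303.05592, Gallinaro2022 arXiv:2203.13767, arXiv:2506.07550 §1.2,
arXiv:1909.10241) only to locate the
frontier. What no prior route does: Zilber files EC whole (EacComplex) and ModulusFirst proves
FINITENESS of exponential points on
curves; this line proves EXISTENCE in the first open ambient dimension for a named family, and files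
the card's summit-side content —
kernel generator e^{−4π²} (transcendence ⟺ e^{π²} ∉ ℚ̄, Waldschmidt2005Periodes Conj. 25 / Ex. 26)
and special points ⟺
ThreeLogarithmsConjecture — as provable-now equivalences, not as consequences (negatives index:
empty).

RANKED CRUXES. #0 CurveMeetsBilinExp (target) — every algebraic subset of (ℂˣ)³ with infinitely many
points (zero locus of an ideal of ℂ[a,b,c] met with the torus) contains a point (e^z, e^w, e^{zw});
i.e. every algebraic curve in (ℂˣ)³ meets the bilinear exponential surface G (card object; EC for
Γ_mult × C, N = 3). (why it might fail: It asserts MORE than EC (no freeness/rotundity asked): a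
curve inside a special configuration (e.g. a, b locked to roots of unity with c forced off
e^{-4π²ℚ}) could dodge every sheet; checked by hand only for lines, cosets {a=1}, {ab=1,c=-1}.)
[arXiv:2409.12860, Gallinaro2022, MantovaMasser2023, BrownawellMasser2017, Marker2006]
#2 PairingExpClosed (crux) — Exponential Closedness holds for every irreducible, rotund, additively
and multiplicatively free V ⊆ ℂ^N × (ℂˣ)^N of dimension N whose additive projection lies in the
pairing graph Γ_{m,n} = {(s, t, (s_i t_j))}, N = m + n + mn, m, n ≥ 1 (the bilinear exponential
G_{m,n} = {(e^s, e^t, e^{s_i t_j})} is exponentially-algebraically closed; card C1 with the squares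
removed). [difficulty: open-problem] (why it might fail: For m ≥ 2 each fast phase e^{2πi l_j s_i}
is shared by a whole row c_{i·}; the sheet reduction leaves slow integrality conditions rotundity
may not make hittable — the engine may stop at m = 1, leaving general non-dominant EC (AKM21 §6: 'F
can oscillate or grow too fast').) [arXiv:2409.12860, arXiv:2105.12679, Gallinaro2022,
arXiv:2506.07550, Zilber2005PseudoExp]
#3 PairingClosedOneN (crux) — the one-multiplier family m = 1 of PairingExpClosed: EC for rotund
free V ⊆ ℂ^{1+2n} × (ℂˣ)^{1+2n} with additive part in Γ_{1,n} = {(s, t, (s t_j))} — "raising to an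
UNKNOWN power": points (a; b; b^{log a}) = (e^s; e^{t_j}; e^{s t_j}) on W. One fast variable s, n
sheet indices l_j; expected proof: sheets l_j = l, s ≈ m/l, then an n-dimensional open-mapping step
for the slow branch data plus a Kronecker-type density of the Heisenberg shifts for the n − 1
integrality conditions. [deps: PairingExpClosed] [difficulty: XL] (why it might fail: For n ≥ 2 the
reduction leaves n−1 slow conditions Δ_j(T) ∈ ℤ + (sheet shifts); if on every chart of W the shifts
act through a rank-deficient lattice (Im Δ_j of fixed sign, ratios rational) the open-mapping step
has no integer to hit, and rotundity/freeness must be shown to forbid this.) [arXiv:2409.12860,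
GallinaroKirby2023, Gallinaro2022, arXiv:1909.10241]
#4 CurveBranchOverRealArc (crux) — algebraic input of X: if Z = V(I) ∩ (ℂˣ)³ is infinite then either
Z contains a whole vertical line {(a₀, b₀, c) : c ≠ 0}, or there is a ball around a REAL point x₀ of
the z-plane with holomorphic B, Γ (Γ zero-free) such that (e^z, e^{B(z)}, Γ(z)) ∈ V(I) on it (branch
of the curve over an arc of positive-real a), or the same with the roles of a and b exchanged
(covers a ≡ const via constant A). [difficulty: XL] (why it might fail: Mathematically routine
(cofinite image of a non-constant coordinate on a component, generic smoothness, holomorphic IFT,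
local log); fails as stated only if the three-way case split misses a configuration. Real risk is
Lean: no algebraic-curve library — needs elimination to a plane model first (XL).) [Marker2006,
arXiv:2409.12860, Kirby2010EAEF]
#9 LargeSheetFixedPoint (support) — analytic engine of X: for holomorphic B, Γ on a ball centred at
a real point x₀ with Γ zero-free there are z in the ball and l ∈ ℤ with e^{z(B(z)+2πil)} = Γ(z)
(Banach fixed point of z ↦ (L(z)+2πim)/(2πil), L = log Γ − zB, on the disc of radius r/4 about m/l,
l ≥ max(K/(πr/2), K′/π, 4/r)). [difficulty: provable-now] [Marker2006, arXiv:2409.12860]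
#9 PairingClosedOfEac (support) — rung certificate: Zilber's Exponential Closedness for ℂ_exp (the
body of route Zilber's EacComplex) implies PairingExpClosed (it is a literal restriction; proved in
the planner's sketch). [difficulty: provable-now] [Zilber2005PseudoExp, arXiv:2409.12860]
#9 OneNOfPairing (support) — ladder sanity: PairingExpClosed specialises to PairingClosedOneN (m =
1; proved in the sketch). [difficulty: provable-now] [arXiv:2409.12860]
#9 HeisenbergFibre (support) — card (H): the fibre of G over (e^z, e^w) is
{e^{zw}·e^{2πi(lz+kw)}·e^{−4π²kl} : k, l ∈ ℤ} — the sheets act through the integer Heisenberg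
cocycle. [difficulty: provable-now] [arXiv:1705.04574, Waldschmidt2005Periodes]
#9 KernelFibre (support) — card (K): the fibre of G over (1, 1) is the cyclic set e^{−4π²ℤ} with
canonical generator τ_G = e^{−4π²}. [difficulty: provable-now] [Waldschmidt2005Periodes,
Zilber2005PseudoExp]
#9 KernelTranscendentalIffExpPiSq (support) — card (K): Zilber's standard-kernel axiom for G ("every
kernel element ≠ 1 is transcendental") is EQUIVALENT to the open transcendence of e^{π²}
(Waldschmidt Conj. 25, Ex. 26; in tree only as transcendental_exp_pi_sq_of_threeLogarithmsConjecture
/ _of_schanuel). [difficulty: provable-now] [Waldschmidt2005Periodes, BakerTNT1975]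
#9 SpecialPointsIffThreeLogs (support) — card (S): the algebraic points of G all have degenerate
witnesses (zw = 0) iff Waldschmidt's three-logarithms conjecture; states the refuter-flagged care
(quantify over witnesses z, w, not over points). [difficulty: provable-now]
[Waldschmidt2005Periodes, Roy1995]

TWO-LAYER PLAN. Foreseen glued splits (nothing filed now): CurveBranchOverRealArc ⇐ PlaneModel
(elimination: Z infinite ⇒ vertical line, or a plane
curve h(a,b)=0 / h(b,c)=0 inside a coordinate projection with a lift of c) → PlaneCurveBranch
(squarefree h, ∂h ≠ 0 off finitely many
points, holomorphic IFT, local log at a positive-real value) → CurveBranchOverRealArc (k = 2).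
PairingClosedOneN ⇐ OneNChart (branch data
of W over the b-torus near a real point) → OneNSheetDensity (the Heisenberg shifts (k, l, sheet of
T) act densely on the n−1 conditions
Δ_j ∈ ℤ) → OneNOpenMapping (quantitative inverse function theorem for (s, Δ₂,…,Δ_n) at a
non-degenerate point, non-degeneracy from
rotundity) (k = 3). PairingExpClosed ⇐ multi-phase density → nondegeneracy-from-rotundity →
PairingExpClosed, only after m = 1 closes.

KILL CRITERIA. A curve C ⊆ (ℂˣ)³ with C ∩ G = ∅ refutes CurveMeetsBilinExp: if C is multiplicatively
free it also refutes Zilber's EC (hand the witness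
to route Zilber's NotEacComplex) — close `refuted:CurveMeetsBilinExp`; if C is special (inside a
torus coset) restate X with
"multiplicatively free" and keep the engine. LargeSheetFixedPoint is proved on paper and
numerically; a refutation can only be a
quantifier slip ⇒ restate. ¬PairingExpClosed or ¬PairingClosedOneN = ¬EC(ℂ): route pivots to its
unconditional rungs and the witness goes
to route Zilber. EacComplex proved elsewhere moots cruxes 2–3 (not X, which also covers non-free
curves). CurveBranchOverRealArc refuted
as stated ⇒ repair the case split (not load-bearing for the line's truth).

NOT DECOMPOSED YET. (i) Generic points: exponential points of C generic over a finitely generated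
field (SEC-type) and Zariski density of C ∩ G in C — the
input the card's quasiminimality target needs; (ii) the card's C2, quasiminimality of ⟨ℂ; +, ·, G⟩
(needs generic pairing-closedness for
all (m,n), CCP for the G-closure, the amalgamation class, and a Lean language/structure for G — no
definition request filed until (i)
moves); (iii) the card's literal Φ₂ with squares (Veronese-split EC: n = 1 is Hadamard–Borel and
provable now, n = 2 needs tropical
control of W at infinity because |e^{z²}| = e^{x²−y²} on large sheets); (iv) complex-coefficient
quadratic parametrisations (complex
powers composed with the pairing, GallinaroKirby2023 territory); (v) counting algebraic points of
bounded height/degree on G over all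
sheets (card S3, arXiv:2202.05305) and every transcendence statement ((K), (S)) beyond the filed
equivalences — no engine is claimed.

CHEAPEST FALSIFIER. Run the engine: sheet_contraction_test.py (planner's folder) iterates z ←
(L(z)+2πim)/(2πil) for C = {b = 1+a, c = a²+3}; RESULT
(2026-08-15): l = 3, 10, 40, 200 all converge in ≤ 9 steps to points of G on C with residuals ≤
3e-13 and arg a = −0.063, −0.019,
−0.005, −0.001 (accumulation at the positive-real wall, as predicted). Next cheapest: (1) vacuity
audit of PairingExpClosed — m = 0 would
be all of EC (excluded by 0 < m, 0 < n); does some admissible (m,n,e,W) exist? yes: Γ_mult × C for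
any multiplicatively free curve C is
irreducible, free, rotund of dimension 3 (rank-by-rank check in NOTES); (2) a refuter's search for a
special curve dodging all sheets
(candidates: C ⊆ {a = ζ, b = ζ′} roots of unity — but these are vertical lines, which meet G).

NUMBERS. Known EC cases (arXiv:2409.12860 §3.3–3.4, arXiv:2506.07550 §1.2): n = 1 (Marker2006); dim
π₁V = n (BrownawellMasser2017 Prop 2);
dim π₁V = 1 without vertical projections (MantovaMasser2023 Thm 1.1) ⇒ all of ℂ² × (ℂˣ)²; L × W, L
linear (Gallinaro2022 Thm 8.8). This
route: N = 3, dim π₁V = 2, π₁V = {u = st} non-linear. Kernel generator τ_G = e^{−4π²} ≈ 7.2e-18.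
Contraction constants: Lipschitz
K′/(2πl), invariance needs l ≥ 2K/(πr); test curve converged already at l = 3. Items at open: 12 (1
target, 1 assembly, 3 cruxes, 7 support).

DEFINITION REQUESTS. None at open: G is inlined as a set comprehension; EC vocabulary
(IsIrreducibleClosed, torusLocus, IsRotund, IsAddFree, IsMulFree,
zariskiDim, expGraph, IsExpAlgClosed) exists in
Literature.NumberTheory.Transcendental.{ExpVarieties,ZilberField};
ThreeLogarithmsConjecture in Literature.Barriers.Schanuel.AlgebraicIndependenceOfLogarithms. A
first-order language/structure for
⟨ℂ; +, ·, G⟩ (for the quasiminimality rung) is deliberately NOT requested yet (see Not decomposed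
yet (ii)).

Novelty: Searches (2026-08-15): READ arXiv:2409.12860 pp.13–15 (Aslanyan–Gallinaro survey: the list of proved
EC cases, Thms 3.6–3.9, "these
results imply Conjecture 3.4 for all subvarieties of ℂ²×(ℂˣ)²"); READ arXiv:2506.07550 §1.2–1.3
(2025: state of the art "[BM, AKM, Gal23,
MM]", analytic characterisation of rotundity of L×W); READ arXiv:1909.10241 (grep: dominant π₁ only;
"a major problem is to replace the
hypothesis that π₁ is dominant"); `lit search` remote cascade "exponential closedness conjecture
exponential point algebraic variety"
--year-from 2019 (25 rows; relevant AKM21, Gallinaro BSL 2023, Aslanyan–Kirby MT 2025, 2506.07550 —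
none non-linear split);
`lit search --hybrid` same words (12 local rows, none relevant); `lit frontier Schanuel --since
2022` (30 rows: Zilber–Pink, p-adic,
zeta values, no EC); `lit galaxy search "exponential-algebraic closedness" --star all` (0) and
`"exponential closedness" --star pdf` (1:
Haykazyan–Kirby arXiv:1812.08271, unrelated); the card's own searches (GK24 arXiv:2304.06450 full
text: no bilinear/quadratic exponent;
Kirby arXiv:1705.04574 §8: proposed variants all linear); openalex/s2/arxiv APIs rate-limited today
(429) — searched-but-not-exhaustive.
Nearest prior art found: Gallinaro2022 (arXiv:2203.13767 Thm 8.8: split L × W with L LINEAR, via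
Khovanskii/Kazarnovskii + tropical
geometry); MantovaMasser2023 (arXiv:2303.05592 Thm 1.1: dim π₁V = 1); BrownawellMasser2017
(dominant); Marker2006 (n = 1 via Hadamard,
zeros near large sheets);  [refs: 2409.12860, 2506.07550, 1909.10241, 1812.08271, 2304.06450, 1705.04574, 2203.13767, 2303.05592, Gallinaro2022, MantovaMasser2023, BrownawellMasser2017, Marker2006, GallinaroKirby2023]

Barriers (technique_class: exponential-closedness, sheet-contraction, bilinear-exp): - technique_class: exponential-closedness, sheet-contraction, bilinear-exp
- Literature.Barriers.Schanuel.AxiomsDoNotForceSchanuel: APPLIES and is embraced — closedness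
statements (X, PairingExpClosed) and any later quasiminimality of ⟨ℂ;+,·,G⟩ imply nothing about SP
(Bays–Kirby 𝔹_P models); the route files e^{π²} / three-logs only as equivalences
(KernelTranscendentalIffExpPiSq, SpecialPointsIffThreeLogs), never as consequences; the bet is an
EC-side theorem at the N = 3 frontier, the same standing as route Zilber's EacComplex.
- Literature.Barriers.Schanuel.AxSchanuelFunctionalNotNumerical: not engaged — no transcendence of a
number is derived; functional transcendence is not even used for rotundity here (X asks no
rotundity).
- Literature.Barriers.Schanuel.AlgebraicIndependenceOfLogarithms: the special-point statement (S) is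
Roy's xy = z² shape (three logs ⊂ four exponentials), certified out of reach of linear-independence
methods; the route relocates it as an equivalence and claims no proof.
- Literature.Barriers.Schanuel.LinearSubgroupMethodLimit: same — (S)/(K) are not attacked; it does
not apply to the existence side.
- Literature.Barriers.Schanuel.SchanuelPropertyNotFirstOrder: not engaged (no first-order transfer;
the quasiminimality rung that would meet it is explicitly not filed).
- Literature.Barriers.Schanuel.LargeTranscendenceDegree, NesterenkoModularScope,
EFunctionValuesAtAlgebraicPoints, PeriodConjectureOverQbarScope, SiegelShidlovskiiRank: other
technique cl

History (route lifecycle, newest last):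
- 2026-08-15T13:50:53Z · CLOSED retired — not-a-thesis: assembly does not conclude the sub-problem Statement (operator:999:1257524)

sub-problem: Schanuel · status: closed(retired) · opened planner-plancard-Schanuel-Schanuel-bilinear-e-0fdf2ca6-0 2026-08-15T12:09:23Z · rev 0 · ledger route-Schanuel-BilinearExp
GENERATED by the gate from the ledger (D-0016/17). Provers cite these decls: `theorem foo : Summit.Schanuel.Schanuel.Theses.BilinearExp.<Decl> := …` in Summits/Schanuel/Schanuel/Theorems/<Name>.lean.
-/

namespace Summit.Schanuel.Schanuel.Theses.BilinearExp

open scoped BigOperators Topology Manifold Classical MeasureTheory ProbabilityTheory Matrix InnerProductSpace ComplexConjugate ContinuousMap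
open Filter Set Function TopologicalSpace MeasureTheory

attribute [summit_statement] _root_.Schanuel

open Literature.Periods

/-- item stmt-Schanuel-7437 · target · rank 0 · closed · moot by None · by planner
why it might fail: It asserts MORE than EC (no freeness/rotundity asked): a curve inside a special configuration (e.g. a, b locked to roots of unity with c forced off e^{-4π²ℚ}) could dodge every sheet; checked by hand only for lines, cosets {a=1}, {ab=1,c=-1}.
sources: arXiv:2409.12860, Gallinaro2022, MantovaMasser2023, BrownawellMasser2017, Marker2006
[target] every algebraic subset of (ℂˣ)³ with infinitely many points (zero locus of an ideal of
ℂ[a,b,c] met with the torus) contains a point (e^z, e^w, e^{zw}); i.e. every algebraic curve in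
(ℂˣ)³ meets the bilinear exponential surface G (card object; EC for Γ_mult × C, N = 3). -/
@[route_item "route-Schanuel-BilinearExp"]
def CurveMeetsBilinExp : Prop :=
  ∀ I : Ideal (MvPolynomial (Fin 3) ℂ), (MvPolynomial.zeroLocus ℂ I ∩ {p | ∀ i, p i ≠ 0}).Infinite → ∃ z w : ℂ, ![Complex.exp z, Complex.exp w, Complex.exp (z * w)] ∈ MvPolynomial.zeroLocus ℂ I

/-- item stmt-Schanuel-7438 · crux · rank 2 · closed · moot by None · by planner
why it might fail: For m ≥ 2 each fast phase e^{2πi l_j s_i} is shared by a whole row c_{i·}; the sheet reduction leaves slow integrality conditions rotundity may not make hittable — the engine may stop at m = 1, leaving general non-dominant EC (AKM21 §6: 'F can oscillate or grow too fast').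
sources: arXiv:2409.12860, arXiv:2105.12679, Gallinaro2022, arXiv:2506.07550, Zilber2005PseudoExp
[crux] Exponential Closedness holds for every irreducible, rotund, additively and multiplicatively
free V ⊆ ℂ^N × (ℂˣ)^N of dimension N whose additive projection lies in the pairing graph Γ_{m,n} =
{(s, t, (s_i t_j))}, N = m + n + mn, m, n ≥ 1 (the bilinear exponential G_{m,n} = {(e^s, e^t, e^{s_i
t_j})} is exponentially-algebraically closed; card C1 with the squares removed). [difficulty:
open-problem] -/
@[route_item "route-Schanuel-BilinearExp"]
def PairingExpClosed : Prop :=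
  ∀ (m n N : ℕ) (e : (Fin m ⊕ Fin n) ⊕ (Fin m × Fin n) ≃ Fin N) (W : Set (Fin N ⊕ Fin N → ℂ)), 0 < m → 0 < n → Literature.NumberTheory.Transcendental.IsIrreducibleClosed ℂ W → (W ∩ Literature.NumberTheory.Transcendental.torusLocus ℂ N).Nonempty → Literature.NumberTheory.Transcendental.IsRotund ℂ N (W ∩ Literature.NumberTheory.Transcendental.torusLocus ℂ N) → Literature.NumberTheory.Transcendental.IsAddFree ℂ N (W ∩ Literature.NumberTheory.Transcendental.torusLocus ℂ N) → Literature.NumberTheory.Transcendental.IsMulFree ℂ N (W ∩ Literature.NumberTheory.Transcendental.torusLocus ℂ N) → Literature.NumberTheory.Transcendental.zariskiDim ℂ W = N → (∀ z ∈ W, ∀ (i : Fin m) (j : Fin n), z (Sum.inl (e (Sum.inr (i, j)))) = z (Sum.inl (e (Sum.inl (Sum.inl i)))) * z (Sum.inl (e (Sum.inl (Sum.inr j))))) → (W ∩ Literature.NumberTheory.Transcendental.expGraph ℂ N).Nonempty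

/-- item stmt-Schanuel-7439 · crux · rank 3 · closed · moot by None · by planner
why it might fail: For n ≥ 2 the reduction leaves n−1 slow conditions Δ_j(T) ∈ ℤ + (sheet shifts); if on every chart of W the shifts act through a rank-deficient lattice (Im Δ_j of fixed sign, ratios rational) the open-mapping step has no integer to hit, and rotundity/freeness must be shown to forbid this.
sources: arXiv:2409.12860, GallinaroKirby2023, Gallinaro2022, arXiv:1909.10241
[crux] the one-multiplier family m = 1 of PairingExpClosed: EC for rotund free V ⊆ ℂ^{1+2n} ×
(ℂˣ)^{1+2n} with additive part in Γ_{1,n} = {(s, t, (s t_j))} — "raising to an UNKNOWN power":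
points (a; b; b^{log a}) = (e^s; e^{t_j}; e^{s t_j}) on W. One fast variable s, n sheet indices l_j;
expected proof: sheets l_j = l, s ≈ m/l, then an n-dimensional open-mapping step for the slow branch
data plus a Kronecker-type density of the Heisenberg shifts for the n − 1 integrality conditions.
[deps: PairingExpClosed] [difficulty: XL] -/
@[route_item "route-Schanuel-BilinearExp"]
def PairingClosedOneN : Prop :=
  ∀ (n N : ℕ) (e : (Fin 1 ⊕ Fin n) ⊕ (Fin 1 × Fin n) ≃ Fin N) (W : Set (Fin N ⊕ Fin N → ℂ)), 0 < n → Literature.NumberTheory.Transcendental.IsIrreducibleClosed ℂ W → (W ∩ Literature.NumberTheory.Transcendental.torusLocus ℂ N).Nonempty → Literature.NumberTheory.Transcendental.IsRotund ℂ N (W ∩ Literature.NumberTheory.Transcendental.torusLocus ℂ N) → Literature.NumberTheory.Transcendental.IsAddFree ℂ N (W ∩ Literature.NumberTheory.Transcendental.torusLocus ℂ N) → Literature.NumberTheory.Transcendental.IsMulFree ℂ N (W ∩ Literature.NumberTheory.Transcendental.torusLocus ℂ N) → Literature.NumberTheory.Transcendental.zariskiDim ℂ W = N → (∀ z ∈ W,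 ∀ (i : Fin 1) (j : Fin n), z (Sum.inl (e (Sum.inr (i, j)))) = z (Sum.inl (e (Sum.inl (Sum.inl i)))) * z (Sum.inl (e (Sum.inl (Sum.inr j))))) → (W ∩ Literature.NumberTheory.Transcendental.expGraph ℂ N).Nonempty

/-- item stmt-Schanuel-7440 · crux · rank 4 · closed · moot by None · by planner
why it might fail: Mathematically routine (cofinite image of a non-constant coordinate on a component, generic smoothness, holomorphic IFT, local log); fails as stated only if the three-way case split misses a configuration. Real risk is Lean: no algebraic-curve library — needs elimination to a plane model first (XL).
sources: Marker2006, arXiv:2409.12860, Kirby2010EAEF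
[crux] algebraic input of X: if Z = V(I) ∩ (ℂˣ)³ is infinite then either Z contains a whole vertical
line {(a₀, b₀, c) : c ≠ 0}, or there is a ball around a REAL point x₀ of the z-plane with
holomorphic B, Γ (Γ zero-free) such that (e^z, e^{B(z)}, Γ(z)) ∈ V(I) on it (branch of the curve
over an arc of positive-real a), or the same with the roles of a and b exchanged (covers a ≡ const
via constant A). [difficulty: XL] -/
@[route_item "route-Schanuel-BilinearExp"]
def CurveBranchOverRealArc : Prop :=
  ∀ I : Ideal (MvPolynomial (Fin 3) ℂ), (MvPolynomial.zeroLocus ℂ I ∩ {p | ∀ i, p i ≠ 0}).Infinite → (∃ a b : ℂ, a ≠ 0 ∧ b ≠ 0 ∧ ∀ c : ℂ, c ≠ 0 → ![a, b, c] ∈ MvPolynomial.zeroLocus ℂ I) ∨ (∃ (x₀ r : ℝ) (B Γ : ℂ → ℂ), 0 < r ∧ DifferentiableOn ℂ B (Metric.ball (x₀ : ℂ) r) ∧ DifferentiableOn ℂ Γ (Metric.ball (x₀ : ℂ) r) ∧ ∀ z ∈ Metric.ball (x₀ : ℂ) r, Γ z ≠ 0 ∧ ![Complex.exp z, Complex.exp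 (B z), Γ z] ∈ MvPolynomial.zeroLocus ℂ I) ∨ (∃ (x₀ r : ℝ) (A Γ : ℂ → ℂ), 0 < r ∧ DifferentiableOn ℂ A (Metric.ball (x₀ : ℂ) r) ∧ DifferentiableOn ℂ Γ (Metric.ball (x₀ : ℂ) r) ∧ ∀ w ∈ Metric.ball (x₀ : ℂ) r, Γ w ≠ 0 ∧ ![Complex.exp (A w), Complex.exp w, Γ w] ∈ MvPolynomial.zeroLocus ℂ I)

/-- item stmt-Schanuel-7441 · support · rank 9 · closed · moot by None · by planner
sources: Marker2006, arXiv:2409.12860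
[support] analytic engine of X: for holomorphic B, Γ on a ball centred at a real point x₀ with Γ
zero-free there are z in the ball and l ∈ ℤ with e^{z(B(z)+2πil)} = Γ(z) (Banach fixed point of z ↦
(L(z)+2πim)/(2πil), L = log Γ − zB, on the disc of radius r/4 about m/l, l ≥ max(K/(πr/2), K′/π,
4/r)). [difficulty: provable-now] -/
@[route_item "route-Schanuel-BilinearExp"]
def LargeSheetFixedPoint : Prop :=
  ∀ (x₀ r : ℝ) (B Γ : ℂ → ℂ), 0 < r → DifferentiableOn ℂ B (Metric.ball (x₀ : ℂ) r) → DifferentiableOn ℂ Γ (Metric.ball (x₀ : ℂ) r) → (∀ z ∈ Metric.ball (x₀ : ℂ) r, Γ z ≠ 0) → ∃ z ∈ Metric.ball (x₀ : ℂ) r, ∃ l : ℤ, Complex.exp (z * (B z + 2 * Real.pi * Complex.I * l)) = Γ z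

/-- item stmt-Schanuel-7442 · support · rank 9 · closed · moot by None · by planner
sources: Zilber2005PseudoExp, arXiv:2409.12860
[support] rung certificate: Zilber's Exponential Closedness for ℂ_exp (the body of route Zilber's
EacComplex) implies PairingExpClosed (it is a literal restriction; proved in the planner's sketch).
[difficulty: provable-now] -/
@[route_item "route-Schanuel-BilinearExp"]
def PairingClosedOfEac : Prop :=
  Literature.NumberTheory.Transcendental.IsExpAlgClosed ℂ → PairingExpClosed

/-- item stmt-Schanuel-7443 · support · rank 9 · closed · moot by None · by planner
sources: arXiv:2409.12860
[support] ladder sanity: PairingExpClosed specialises to PairingClosedOneN (m = 1; proved in the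
sketch). [difficulty: provable-now] -/
@[route_item "route-Schanuel-BilinearExp"]
def OneNOfPairing : Prop :=
  PairingExpClosed → PairingClosedOneN

/-- item stmt-Schanuel-7444 · support · rank 9 · closed · moot by None · by planner
sources: arXiv:1705.04574, Waldschmidt2005Periodes
[support] card (H): the fibre of G over (e^z, e^w) is {e^{zw}·e^{2πi(lz+kw)}·e^{−4π²kl} : k, l ∈ ℤ}
— the sheets act through the integer Heisenberg cocycle. [difficulty: provable-now] -/
@[route_item "route-Schanuel-BilinearExp"]
def HeisenbergFibre : Prop :=
  ∀ z w c : ℂ, (∃ z' w' : ℂ, Complex.exp z' = Complex.exp z ∧ Complex.exp w' = Complex.exp w ∧ Complex.exp (z' * w') = c) ↔ ∃ k l : ℤ, c = Complex.exp (z * w + 2 * Real.pi * Complex.I * (l * z + k * w) - 4 * Real.pi ^ 2 * (k * l))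

/-- item stmt-Schanuel-7445 · support · rank 9 · closed · moot by None · by planner
sources: Waldschmidt2005Periodes, Zilber2005PseudoExp
[support] card (K): the fibre of G over (1, 1) is the cyclic set e^{−4π²ℤ} with canonical generator
τ_G = e^{−4π²}. [difficulty: provable-now] -/
@[route_item "route-Schanuel-BilinearExp"]
def KernelFibre : Prop :=
  {c : ℂ | ∃ z w : ℂ, Complex.exp z = 1 ∧ Complex.exp w = 1 ∧ Complex.exp (z * w) = c} = Set.range (fun m : ℤ => Complex.exp (-(4 * Real.pi ^ 2 * m)))

/-- item stmt-Schanuel-7446 · support · rank 9 · closed · moot by None · by planner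
sources: Waldschmidt2005Periodes, BakerTNT1975
[support] card (K): Zilber's standard-kernel axiom for G ("every kernel element ≠ 1 is
transcendental") is EQUIVALENT to the open transcendence of e^{π²} (Waldschmidt Conj. 25, Ex. 26; in
tree only as transcendental_exp_pi_sq_of_threeLogarithmsConjecture / _of_schanuel). [difficulty:
provable-now] -/
@[route_item "route-Schanuel-BilinearExp"]
def KernelTranscendentalIffExpPiSq : Prop :=
  (∀ c : ℂ, (∃ z w : ℂ, Complex.exp z = 1 ∧ Complex.exp w = 1 ∧ Complex.exp (z * w) = c) → c ≠ 1 → Transcendental ℚ c) ↔ Transcendental ℚ (Real.exp (Real.pi ^ 2))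

/-- item stmt-Schanuel-7447 · support · rank 9 · closed · moot by None · by planner
sources: Waldschmidt2005Periodes, Roy1995
[support] card (S): the algebraic points of G all have degenerate witnesses (zw = 0) iff
Waldschmidt's three-logarithms conjecture; states the refuter-flagged care (quantify over witnesses
z, w, not over points). [difficulty: provable-now] -/
@[route_item "route-Schanuel-BilinearExp"]
def SpecialPointsIffThreeLogs : Prop :=
  Literature.Barriers.Schanuel.ThreeLogarithmsConjecture ↔ ∀ z w : ℂ, IsAlgebraic ℚ (Complex.exp z) → IsAlgebraic ℚ (Complex.exp w) → IsAlgebraic ℚ (Complex.exp (z * w)) → z * w = 0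

/-- item stmt-Schanuel-7448 · assembly · rank 1 · closed · moot by None · by planner
sources: Marker2006, arXiv:2409.12860
[assembly] LargeSheetFixedPoint → CurveBranchOverRealArc → CurveMeetsBilinExp. -/
@[route_item "route-Schanuel-BilinearExp"]
def Assembly : Prop :=
  LargeSheetFixedPoint → CurveBranchOverRealArc → CurveMeetsBilinExp

end Summit.Schanuel.Schanuel.Theses.BilinearExp
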